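import Literature.AlgebraicGeometry.Frobenioids.Prop55SubRatStdSlot
import Literature.AlgebraicGeometry.Frobenioids.PerfectionModelType
import Literature.AlgebraicGeometry.Frobenioids.PerfectionFrobeniusCompactHolds
import Literature.AlgebraicGeometry.Frobenioids.PerfectionUnitsIsoGeneral
import Literature.AlgebraicGeometry.Frobenioids.PerfectionPrimes
import Literature.AlgebraicGeometry.Frobenioids.MonoidTransport
import Literature.AlgebraicGeometry.Frobenioids.BiratSubfunctor
import Literature.AlgebraicGeometry.Frobenioids.IsometricPreStepsPullback
import HarnessLib

/-!
# Frobenioids I, Proposition 5.5 (iii): "if `C` is of … rationally standard … type, then so is `C^pf`" —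
# Def. 4.5 (ii) "rational type" passes to THE perfection, and the RATIONALLY-STANDARD slot of
# `Prop55Sub.lean` (abc-iut cell, layer L1, node `FrdI:Prop5.5(iii)`, sub-DAG row `FrdI:Prop5.5(iii)/P55-L06`,
# slot `FrdI.Prop55Sub.Prop55iii_pf_ratStd`)

Mochizuki, *The geometry of Frobenioids I: the general theory*, Kyushu J. Math. **62** (2008)
293–400, §5, Proposition 5.5 (iii), kurims text p. 104 ll. 36–37 (statement), proof p. 105 ll. 11–20;
Def. 4.5 (ii)/(iii) p. 86 ("`A` is *strictly rational* if for every prime `𝔭 ∈ Prime(Φ(A))` there is an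
element `a − b ∈ Φ^birat(A)`, `a, b ∈ Φ(A)`, with `𝔭 ∈ Supp(a)`, `𝔭 ∉ Supp(b)`; *rational* if some pull-back
morphism `A' → A` has strictly rational domain"), Def. 2.4 (i)(d) p. 47 (`Supp`), §0 p. 12
(`Prime(M) ≅ Prime(M^pf)`). [cite: MochizukiFrdI2008, Prop. 5.5 (iii) p.104]

PROOF-ONLY companion (no definitions).  The slot `FrdI.Prop55Sub.Prop55iii_pf_ratStd hF Supp SuppPf`
(seat abc-iut-w4-d084) carries TWO FREE support predicates, `Supp` on `Φ` and an UNRELATED `SuppPf` on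
`Φ^pf`; as for its sibling `Prop55iii_untr_rlf_ratStd` (GAP row P55iii-F1, seat abc-iut-w5-d250) it is
therefore not closable for arbitrary `SuppPf`, and is closed here AT THE CANONICAL SUPPORT `PrimarySupp` of
Def. 2.4 (i)(d) (`Prop55SubRatStdSlot.lean`: "`𝔭 ∈ Supp(a)` iff some primary `a₀` of the class `𝔭` satisfies
`a₀ ≼ a`") on BOTH `Φ` and `Φ^pf`.  Contents:

* support bookkeeping: `primarySupp_iff_precsim` (the support only sees one primary of the class),
  `primarySupp_map_mulEquiv_iff` (transport along `M ≅ N`, `Primes.congr`) and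
  `primarySupp_perfectionOf_iff` (transport along `M → M^pf`, `Primes.perfectionEquiv`: the natural map
  preserves and reflects `≼`, `Perfection.of_precsim_of_iff`);
* **`Φ^birat ⊆ (Φ^pf)^birat` along `Φ → Φ^pf`** (`map_mem_biratSubgroup_perfection`): the image under
  `Φ^gp → (Φ^pf)^gp` of the rational-function subfunctor of `C` (abc-iut-L1-t5's `biratSubfunctor F`, generated
  by the germs `Φ(δ₁)⁻¹Div(δ₁) − Φ(δ₂)⁻¹Div(δ₂)` of base-equivalent pre-steps) lies in that of `C^pf → F_{Φ^pf}`: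
  `C → C^pf` carries the pair `(δ₁, δ₂)` to such a pair of `C^pf` (Prop. 3.2 (ii): co-angular pre-steps,
  pre-steps, `Base` preserved — seat abc-iut-L1-d9) with germ the image of the germ (`Div` of the image is
  `Div(δ)^{1/1}`, `div_toPf`), and `biratSubfunctor F` is the SMALLEST pull-back-stable family containing the
  germs (`biratSubfunctor_le`);
* **Def. 4.5 (ii) for `C^pf`** (`isRational_perfection_of`): every object `X = (A, n)` of `C^pf` receives a
  pull-back morphism `W → X` over the base of a strictly rational pull-back source `A' → A` of `A` (Def. 1.3
  (i)(c) for the Frobenioid `C^pf`, hypothesis `hPf` = Prop. 3.2 (iii)), and `W` is strictly rational: the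
  witnesses `a − b ∈ Φ^birat(Base A')` map to `(Φ^pf)^birat(Base W)` along `Φ → Φ^pf` and the base
  isomorphism `Base W ≅ Base A'`, supports unchanged;
* CLOSERS of the slot at `PrimarySupp`/`PrimarySupp`:
  `FrdI.Prop55Sub.prop55iii_pf_ratStd_primarySupp_of hF hBi hK` and `…_of_isOfIsotropicType hF hiso hK` —
  Def. 4.5 (iii)(a) for `C^pf`: birationally Frobenius-normalized (seat abc-iut-w5-d042,
  `isOfBiratFrobeniusNormalizedType_biratData_perfection`, GIVEN "`C^birat` is a Frobenioid", Prop. 4.4 (ii),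
  `hBi` — DISCHARGED for isotropic `C` by seat abc-iut-w5-d227), rational (this file), standard (seats
  abc-iut-w5-d042 / w5-d190 / L1-d9, `prop55iii_pf_standard_of_prop55i` + `prop55i_holds`, GIVEN Prop. 3.2
  (iii) = the slot's own binder `hPf`); Def. 4.5 (iii)(b) "`((C^pf)^un-tr)^birat` admits a Frobenius-compact
  object" is carried BY HYPOTHESIS `hK` (print p. 105 ll. 13–20 derives it through Prop. 5.5 (i)/(ii) applied
  to `(C^un-tr)^birat`; no constructor of a Frobenius-compact object of any `(−)^un-tr)^birat` is in the tree —
  the analogue of sub-row P55-L07c/K).  CONDITIONAL on `hK` (and `hBi`, resp. isotropy), said so.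
No statement of the paper is strengthened; nothing here bears on [IUTchIII] Cor. 3.12.
-/

namespace Literature.AlgebraicGeometry.Frobenioids

open CategoryTheory Opposite

universe w v v' u u'

/-! ### The canonical support predicate: one primary per class; transport along `≅` and along `M → M^pf` -/

section Supp

variable {M : Type w} [CommMonoid M] {N : Type w} [CommMonoid N]

/-- `𝔭 ∈ Supp(a)` iff `c ≼ a` for ANY primary `c` of the class `𝔭` (primaries of one class are
`≼`-equivalent). [cite: MochizukiFrdI2008, Def. 2.4 (i) p.47] -/
theorem primarySupp_iff_precsim {c : M} (hc : IsPrimary c) (a : M) :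
    PrimarySupp a (Quotient.mk (primarySetoid M) ⟨c, hc⟩) ↔ c ≼ a := by
  constructor
  · rintro ⟨a₀, h₀, hcls, hle⟩
    have h : a₀ ≼ c := Quotient.exact hcls
    exact (hc.2 a₀ h₀.1 h).trans hle
  · intro h
    exact ⟨c, hc, rfl, h⟩

/-- The support is transported along an isomorphism of monoids `e : M ≅ N` (primes by `Primes.congr e`).
[cite: MochizukiFrdI2008, Def. 2.4 (i) p.47] -/
theorem primarySupp_map_mulEquiv_iff (e : M ≃* N) (a : M) (𝔭 : Primes M) :
    PrimarySupp (e a) (Primes.congr e 𝔭) ↔ PrimarySupp a 𝔭 := by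
  induction 𝔭 using Quotient.inductionOn with
  | h c =>
    obtain ⟨c, hc⟩ := c
    rw [Primes.congr_mk e c hc (hc.map_mulEquiv e), primarySupp_iff_precsim, primarySupp_iff_precsim]
    exact precsim_map_iff e

/-- The support is unchanged along `M → M^pf` (for sharp `M`; primes by `Prime(M) ≅ Prime(M^pf)`,
§0 p. 12): `𝔮(𝔭) ∈ Supp(a)` in `M^pf` iff `𝔭 ∈ Supp(a)` in `M`. [cite: MochizukiFrdI2008, Def. 2.4 (i) p.47] -/
theorem primarySupp_perfectionOf_iff (hM : IsSharp M) (a : M) (𝔭 : Primes M) :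
    PrimarySupp (Perfection.of M a) (Primes.perfectionEquiv hM 𝔭) ↔ PrimarySupp a 𝔭 := by
  induction 𝔭 using Quotient.inductionOn with
  | h c =>
    obtain ⟨c, hc⟩ := c
    rw [Primes.perfectionEquiv_mk hM c hc ((Perfection.isPrimary_of_iff hM).mpr hc), primarySupp_iff_precsim,
      primarySupp_iff_precsim]
    exact Perfection.of_precsim_of_iff

end Supp

namespace PreFrobenioid

variable {D : Type u} [Category.{v} D] {Φ : Dᵒᵖ ⥤ CommMonCat.{w}}
  {C : Type u'} [Category.{v'} C] {F : C ⥤ ElemFrobenioid Φ}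

namespace Perfection

/-! ### `Φ^birat ⊆ (Φ^pf)^birat` along `Φ → Φ^pf` -/

/-- For a base-isomorphism `δ : Y → A` of `C`, the element `Φ(δ)⁻¹Div(δ)` of its image `[δ] : (Y,1) → (A,1)` in
`C^pf` (for `C^pf → F_{Φ^pf}`) is the image `(Φ(δ)⁻¹Div(δ))^{1/1}` of that of `δ` (Prop. 3.2 (i)(ii): `Base[δ] =
Base δ`, `Div[δ] = Div(δ)^{1/1}`). [cite: MochizukiFrdI2008, Prop. 3.2 (ii) p.59] -/
theorem invDiv_toPf_map {hF : IsFrobenioid F} {Y A : C} (δ : Y ⟶ A) (h : IsBaseIso F δ)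
    (h' : IsBaseIso (ops hF).toFunctor ((toPf hF).map δ)) :
    invDiv (ops hF).toFunctor ((toPf hF).map δ) h' =
      Frobenioids.Perfection.of _ (invDiv F δ h) := by
  haveI : IsIso (Base F δ) := h
  haveI : IsIso (Base (ops hF).toFunctor ((toPf hF).map δ)) := h'
  have hinv : inv (Base (ops hF).toFunctor ((toPf hF).map δ)) = inv (Base F δ) := by
    apply IsIso.inv_eq_of_hom_inv_id
    change Hom.baseMap ((toPf hF).map δ) ≫ inv (Base F δ) = 𝟙 _
    rw [baseMap_toPf]
    exact IsIso.hom_inv_id _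
  unfold invDiv
  rw [hinv]
  change Frobenioids.Perfection.map (pull Φ (inv (Base F δ))) (Hom.div ((toPf hF).map δ)) = _
  rw [div_toPf, Frobenioids.Perfection.map_mk]
  rfl

/-- Naturality of `Φ^gp → (Φ^pf)^gp` with respect to the pull-back maps: `(Φ^pf)^gp(g) ∘ (−)^pf = (−)^pf ∘ Φ^gp(g)`.
[cite: MochizukiFrdI2008, Def. 1.1 (ii) p.19] -/
theorem monGpMap_perfectionOf_pullGp (hF : IsFrobenioid F) {X Y : D} (g : X ⟶ Y)
    (c : Algebra.GrothendieckGroup (Φ.obj (op Y))) :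
    MonGp.map (Frobenioids.Perfection.of (Φ.obj (op X))) (pullGp Φ g c) =
      pullGp (ops hF).monFunctor g (MonGp.map (Frobenioids.Perfection.of (Φ.obj (op Y))) c) := by
  have hnat : (MonGp.map (Frobenioids.Perfection.of (Φ.obj (op X)))).comp (pullGp Φ g) =
      (pullGp (ops hF).monFunctor g).comp (MonGp.map (Frobenioids.Perfection.of (Φ.obj (op Y)))) := by
    refine MonGp.hom_ext fun a => ?_
    change MonGp.map _ (pullGp Φ g (Algebra.GrothendieckGroup.of a)) =
      pullGp (ops hF).monFunctor g (MonGp.map _ (Algebra.GrothendieckGroup.of a))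
    rw [pullGp_of, MonGp.map_of, MonGp.map_of, pullGp_of]
    rfl
  exact DFunLike.congr_fun hnat c

/-- **`Φ^birat(X) ⊆ (Φ^pf)^birat(X)` along `Φ(X)^gp → (Φ(X)^pf)^gp`**: the rational-function subfunctor of `C`
(generated by the germs of base-equivalent pairs of pre-steps, abc-iut-L1-t5) maps into that of
`C^pf → F_{Φ^pf}`, because `C → C^pf` carries such pairs to such pairs with the image germ (Prop. 3.2 (ii)) and
`Φ^birat` is the smallest pull-back-stable family containing the germs. [cite: MochizukiFrdI2008, Prop. 5.5 (iii) p.104] -/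
theorem map_mem_biratSubgroup_perfection (hF : IsFrobenioid F) (X : D)
    {c : Algebra.GrothendieckGroup (Φ.obj (op X))} (hc : c ∈ biratSubgroup F X) :
    MonGp.map (Frobenioids.Perfection.of (Φ.obj (op X))) c ∈ biratSubgroup (ops hF).toFunctor X := by
  -- the family `X ↦ (preimage of (Φ^pf)^birat(X))` is a pull-back-stable family of subgroups of `Φ^gp` …
  let Ψ : GpSubfunctor Φ :=
    { carrier := fun X => (biratSubgroup (ops hF).toFunctor X).comap
        (MonGp.map (Frobenioids.Perfection.of (Φ.obj (op X))))
      pull_mem := by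
        intro X Y g c hc
        rw [Subgroup.mem_comap] at hc ⊢
        exact monGpMap_perfectionOf_pullGp hF g c ▸ (biratSubfunctor (ops hF).toFunctor).pull_mem g hc }
  -- … containing the germs of `C`: the image of the germ of `(δ₁, δ₂)` is the germ of `([δ₁], [δ₂])`
  have hgerms : ∀ A : C, biratGerms F A ⊆ (Ψ.carrier (baseObj F A) : Set _) := by
    rintro A _ ⟨Y, δ₁, δ₂, h₁, h₂, hb, rfl⟩
    change MonGp.map _ _ ∈ biratSubgroup (ops hF).toFunctor (baseObj F A)
    have h₁' : IsCoAngularPreStep (ops hF).toFunctor ((toPf hF).map δ₁) :=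
      ⟨(PreFrobenioidData.ofFunctor_isCoAngular (ops hF).toFunctor _).mp
          (preservesMor_isCoAngular hF δ₁ ((PreFrobenioidData.ofFunctor_isCoAngular F δ₁).mpr h₁.1)),
        preservesMor_isPreStep hF δ₁ h₁.2⟩
    have h₂' : IsPreStep (ops hF).toFunctor ((toPf hF).map δ₂) := preservesMor_isPreStep hF δ₂ h₂
    have hb' : BaseEquivalent (ops hF).toFunctor ((toPf hF).map δ₁) ((toPf hF).map δ₂) := by
      change Hom.baseMap ((toPf hF).map δ₁) = Hom.baseMap ((toPf hF).map δ₂)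
      rw [baseMap_toPf, baseMap_toPf]
      exact hb
    have hg := mem_biratSubfunctor_of_mem_biratGerms (ops hF).toFunctor
      ⟨(toPf hF).obj Y, (toPf hF).map δ₁, (toPf hF).map δ₂, h₁', h₂', hb', rfl⟩
    rw [invDiv_toPf_map δ₁ h₁.2.2 h₁'.2.2, invDiv_toPf_map δ₂ h₂.2 h₂'.2] at hg
    rw [map_div, MonGp.map_of, MonGp.map_of]
    exact hg
  exact biratSubfunctor_le F Ψ hgerms X hc

/-! ### Def. 4.5 (ii) for `C^pf` -/

/-- The pull-back maps of `Φ^pf` along an isomorphism of `D` form an isomorphism of monoids.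
[cite: MochizukiFrdI2008, Def. 1.1 (ii) p.19] -/
theorem exists_mulEquiv_pull {hF : IsFrobenioid F} {X₀ X₁ : D} (i : X₁ ≅ X₀) :
    ∃ ε : (ops hF).Mon X₀ ≃* (ops hF).Mon X₁, ∀ x, ε x = (ops hF).pull i.hom x :=
  ⟨MonoidHom.toMulEquiv ((ops hF).pull i.hom) ((ops hF).pull i.inv)
      (MonoidHom.ext fun x => by
        change (ops hF).pull i.inv ((ops hF).pull i.hom x) = x
        rw [← (ops hF).pull_comp, Iso.inv_hom_id, (ops hF).pull_id])
      (MonoidHom.ext fun x => by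
        change (ops hF).pull i.hom ((ops hF).pull i.inv x) = x
        rw [← (ops hF).pull_comp, Iso.hom_inv_id, (ops hF).pull_id]),
    fun _ => rfl⟩

/-- **Def. 4.5 (ii) for `C^pf` from `C`** (at THE support `PrimarySupp` of Def. 2.4 (i)(d), for `C^pf → F_{Φ^pf}`
GIVEN that it is a Frobenioid, Prop. 3.2 (iii), hypothesis `hPf` — used for Def. 1.3 (i)(c): pull-back
morphisms of `C^pf` over a given base arrow): if every object of `C` is rational then so is every object
`X = (A, n)` of `C^pf`.  A strictly rational pull-back source `A' → A` of `A` gives a pull-back morphism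
`W → X` of `C^pf` over `Base A' → Base A = Base X` with `Base W ≅ Base A'`; the witnesses
`a − b ∈ Φ^birat(Base A')` of the strict rationality of `A'` map to witnesses in `(Φ^pf)^birat(Base W)`
(`map_mem_biratSubgroup_perfection`, pull-back along the base isomorphism), supports unchanged
(`primarySupp_perfectionOf_iff`, `primarySupp_map_mulEquiv_iff`). [cite: MochizukiFrdI2008, Prop. 5.5 (iii) p.104] -/
theorem isRational_perfection_of (hF : IsFrobenioid F) (hPf : IsFrobenioid (ops hF).toFunctor)
    {hsq : HasBiratSquares F} {hsq' : HasBiratSquares (ops hF).toFunctor}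
    (hrat : ∀ A : C, PreFrobenioidData.IsRational (biratData hF hsq) (S := PreFrobenioidData.ofFunctor Φ F)
      (fun a 𝔭 => PrimarySupp a 𝔭) A)
    (X : Perfection hF) :
    PreFrobenioidData.IsRational (biratData hPf hsq') (S := PreFrobenioidData.ofFunctor _ (ops hF).toFunctor)
      (fun a 𝔭 => PrimarySupp a 𝔭) X := by
  obtain ⟨A', φ, hφ, hsr⟩ := hrat X.obj
  have hφ' : PreFrobenioid.IsPullbackMorphism F φ := (PreFrobenioidData.ofFunctor_isPullbackMorphism F φ).mp hφ
  -- a pull-back morphism `ψ : W → X` of `C^pf` over `Base φ`, `Base W ≅ Base A'` (Def. 1.3 (i)(c) for `C^pf`)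
  obtain ⟨W, ψ, i, hψ, -⟩ :=
    exists_isPullbackMorphism_over hPf X (show baseObj F A' ⟶ baseObj (ops hF).toFunctor X from Base F φ)
  refine ⟨W, ψ, (PreFrobenioidData.ofFunctor_isPullbackMorphism (ops hF).toFunctor ψ).mpr hψ, fun 𝔮 => ?_⟩
  -- notation: `M = Φ(Base A')`, `ε : M^pf ≅ Φ^pf(Base W)` the pull-back along `i`
  have hM : IsSharp (Φ.obj (op (baseObj F A'))) := (hF.isPreFrobenioid.isDivisorial (baseObj F A')).isSharp
  obtain ⟨ε, hε⟩ := exists_mulEquiv_pull (hF := hF) i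
  change Primes ((ops hF).Mon (baseObj F W.obj)) at 𝔮
  -- the prime of `Φ(Base A')` under `𝔮`, and the witnesses of the strict rationality of `A'` there
  obtain ⟨a, b, hab, ha, hb⟩ := hsr ((Primes.perfectionEquiv hM).symm (Primes.congr ε.symm 𝔮))
  change ↥(Φ.obj (op (baseObj F A'))) at a b
  change Algebra.GrothendieckGroup.of a / Algebra.GrothendieckGroup.of b ∈ biratSubgroup F (baseObj F A') at hab
  change PrimarySupp a _ at ha
  change ¬ PrimarySupp b _ at hb
  have h𝔮 : Primes.congr ε (Primes.perfectionEquiv hM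
      ((Primes.perfectionEquiv hM).symm (Primes.congr ε.symm 𝔮))) = 𝔮 := by
    rw [Equiv.apply_symm_apply, ← Primes.congr_symm, Equiv.apply_symm_apply]
  refine ⟨ε (Frobenioids.Perfection.of _ a), ε (Frobenioids.Perfection.of _ b), ?_, ?_, ?_⟩
  · -- `of (ε a) / of (ε b)` is the pull-back along `i` of the image of `a − b` in `(Φ^pf)^birat(Base A')`
    change _ ∈ biratSubgroup (ops hF).toFunctor (baseObj F W.obj)
    have h1 := map_mem_biratSubgroup_perfection hF (baseObj F A') hab
    have h2 := (biratSubfunctor (ops hF).toFunctor).pull_mem i.hom h1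
    have heq : pullGp (ops hF).monFunctor i.hom
        (MonGp.map (Frobenioids.Perfection.of (Φ.obj (op (baseObj F A'))))
          (Algebra.GrothendieckGroup.of a / Algebra.GrothendieckGroup.of b)) =
        Algebra.GrothendieckGroup.of (ε (Frobenioids.Perfection.of _ a)) /
          Algebra.GrothendieckGroup.of (ε (Frobenioids.Perfection.of _ b)) := by
      rw [← monGpMap_perfectionOf_pullGp hF i.hom, map_div, pullGp_of, pullGp_of, map_div, MonGp.map_of,
        MonGp.map_of, hε, hε]
      rfl
    exact heq ▸ h2
  · show PrimarySupp (ε (Frobenioids.Perfection.of _ a)) 𝔮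
    exact h𝔮 ▸ (primarySupp_map_mulEquiv_iff ε _ _).mpr ((primarySupp_perfectionOf_iff hM a _).mpr ha)
  · show ¬ PrimarySupp (ε (Frobenioids.Perfection.of _ b)) 𝔮
    intro h
    have h' : PrimarySupp (ε (Frobenioids.Perfection.of _ b)) (Primes.congr ε (Primes.perfectionEquiv hM
        ((Primes.perfectionEquiv hM).symm (Primes.congr ε.symm 𝔮)))) := h𝔮.symm ▸ h
    exact hb ((primarySupp_perfectionOf_iff hM b _).mp ((primarySupp_map_mulEquiv_iff ε _ _).mp h'))

end Perfection

end PreFrobenioid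

/-! ### Proposition 5.5 (iii), first sentence, "rationally standard": the slot at the canonical support -/

namespace FrdI.Prop55Sub

open PreFrobenioid

variable {D : Type u} [Category.{v} D] {Φ : Dᵒᵖ ⥤ CommMonCat.{w}}
  {C : Type u'} [Category.{v'} C] {F : C ⥤ ElemFrobenioid Φ}

/-- **Proposition 5.5 (iii), "if `C` is of … rationally standard … type, then so is `C^pf`"** — the slot
`Prop55iii_pf_ratStd F hF Supp SuppPf` AT THE CANONICAL SUPPORT (`Supp = SuppPf = PrimarySupp`, Def. 2.4 (i)(d);
for an arbitrary unrelated `SuppPf` the slot is not closable, as for GAP row P55iii-F1), GIVEN (1) "`C^birat` is a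
Frobenioid" (Prop. 4.4 (ii), `hBi`, cone node `FrdI:Prop4.4(ii)` — for the birational conjunct of Def. 4.5
(iii)(a), seat abc-iut-w5-d042) and (2) Def. 4.5 (iii)(b) for `C^pf`: "`((C^pf)^un-tr)^birat` admits a
Frobenius-compact object" (`hK`; no constructor in the tree — the analogue of sub-row P55-L07c/K).  The other
two clauses of Def. 4.5 (iii)(a) are DISCHARGED: rational (`isRational_perfection_of`) and standard
(`prop55iii_pf_standard_of_prop55i` with Prop. 5.5 (i) `prop55i_holds`, seats abc-iut-w5-d042 / w5-d190 / L1-d9;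
Prop. 3.2 (iii) is the slot's own binder `hPf`).  CONDITIONAL on (1) and (2), said so.
[cite: MochizukiFrdI2008, Prop. 5.5 (iii) p.104] -/
theorem prop55iii_pf_ratStd_primarySupp_of (hF : IsFrobenioid F)
    (hBi : IsFrobenioid (biratOps hF (hasBiratSquares_of_isFrobenioid hF)).toFunctor)
    (hK : ∀ hPf : IsFrobenioid (Perfection.ops hF).toFunctor,
      ∃ Y : Birat (untrFunctor hPf) (isFrobenioid_untr hPf) (hasBiratSquares_untr hPf),
        (PreFrobenioidData.ofFunctor (zeroMonoid D)
          (Birat.toElemZero (isFrobenioid_untr hPf) (hasBiratSquares_untr hPf))).IsFrobeniusCompact Y) :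
    Prop55iii_pf_ratStd F hF (fun a 𝔭 => PrimarySupp a 𝔭) (fun a 𝔭 => PrimarySupp a 𝔭) := by
  intro hfi hfn hPf hR
  exact
    { biratFrobNormalized := PerfectionBirat.isOfBiratFrobeniusNormalizedType_biratData_perfection hPf
        (hasBiratSquares_of_isFrobenioid hPf) hBi hR.biratFrobNormalized
      rational := Perfection.isRational_perfection_of hF hPf hR.rational
      standard := prop55iii_pf_standard_of_prop55i hF hPf (fun A => prop55i_holds hF A) hfi hfn hR.standard
      frobCompact := hK hPf }

/-- **The same for `C` of ISOTROPIC type**, with Prop. 4.4 (ii) DISCHARGED (seat abc-iut-w5-d227,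
`isFrobenioid_biratData_ops_toFunctor'`, from the slot's own birational Frobenius-normalization of `C`):
`Prop55iii_pf_ratStd F hF PrimarySupp PrimarySupp` CONDITIONAL only on "`C` of isotropic type" (print's standing
hypothesis of Def. 2.7 / Def. 4.5 (i)) and on Def. 4.5 (iii)(b) for `C^pf` (`hK`).
[cite: MochizukiFrdI2008, Prop. 5.5 (iii) p.104] -/
theorem prop55iii_pf_ratStd_primarySupp_of_isOfIsotropicType (hF : IsFrobenioid F) (hiso : IsOfIsotropicType F)
    (hK : ∀ hPf : IsFrobenioid (Perfection.ops hF).toFunctor,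
      ∃ Y : Birat (untrFunctor hPf) (isFrobenioid_untr hPf) (hasBiratSquares_untr hPf),
        (PreFrobenioidData.ofFunctor (zeroMonoid D)
          (Birat.toElemZero (isFrobenioid_untr hPf) (hasBiratSquares_untr hPf))).IsFrobeniusCompact Y) :
    Prop55iii_pf_ratStd F hF (fun a 𝔭 => PrimarySupp a 𝔭) (fun a 𝔭 => PrimarySupp a 𝔭) :=
  fun hfi hfn hPf hR =>
    prop55iii_pf_ratStd_primarySupp_of hF
      (isFrobenioid_biratData_ops_toFunctor' hF hiso fun A =>
        (isBiratFrobeniusNormalized_iff_biratData A).mpr (hR.biratFrobNormalized.obj A))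
      hK hfi hfn hPf hR

end FrdI.Prop55Sub

end Literature.AlgebraicGeometry.Frobenioids
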